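import Mathlib.Combinatorics.SimpleGraph.Walk.Counting
import Mathlib.Combinatorics.SimpleGraph.Paths
import Mathlib.Topology.Algebra.InfiniteSum.ENNReal
import Summits.CriticalPhenomena.SAWScalingLimit.Theorems.SAWTotalPositivityBoundaryTP2Defs
import HarnessLib

/-!
# Crux `BoundaryTP2` (stmt-CriticalPhenomena-7115), line `Sketch`: factorisation across a one-edge cut

For the fugacity-`x` self-avoiding path kernel `Z_H(a,b) = pathKernel H x a b = Σ_{γ : a → b} x^{|γ|}`
(an `ℝ≥0∞`-valued `tsum` over Mathlib's `SimpleGraph.Path`): if a vertex set `A` is left by exactly one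
oriented edge `e₁ → e₂` of `H` (`e₂ ∉ A`; by symmetry of adjacency `{e₁, e₂}` is then the only edge of `H`
between `A` and its complement), then for `a ∈ A`, `b ∉ A` and `0 ≤ x`

  `Z_H(a,b) = x · Z_A(a,e₁) · Z_{Aᶜ}(e₂,b)`,

where `Z_A` is the kernel of the part of `H` inside `A`
(`SimpleGraph.fromRel fun u v => H.Adj u v ∧ u ∈ A ∧ v ∈ A`) and `Z_{Aᶜ}` the kernel of the part of `H`
outside `A` (`stub_oneEdgeCut_factor`, a registered stub of the line's skeleton: the rank-one bottleneck
tool).  Proof: a self-avoiding path `a → b` uses the edge `{e₁, e₂}` exactly once, so it splits uniquely as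
(self-avoiding path `a → e₁` inside `A`) · `e₁e₂` · (self-avoiding path `e₂ → b` outside `A`); conversely any
such concatenation is self-avoiding (the two pieces live in disjoint vertex sets).  This bijection
(`exists_oneEdgeCut_split`; the pieces are moved between `H` and its parts with `SimpleGraph.Walk.transfer`)
has `|γ| = |prefix| + |suffix| + 1`, and the kernel identity follows from `Function.Injective.tsum_eq`,
`ENNReal.tsum_prod'`, `ENNReal.tsum_mul_left/right` and `ENNReal.ofReal_mul` (`0 ≤ x`).  No finiteness of
`H` is needed; everything is proved, Mathlib only. [folklore]
-/

noncomputable section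

namespace Summit.CriticalPhenomena.SAWScalingLimit.Theorems.BoundaryTP2

open scoped ENNReal

variable {V : Type*}

/-- Adjacency in the part of `H` cut out by a vertex predicate `P`
(`SimpleGraph.fromRel fun u v => H.Adj u v ∧ P u ∧ P v`): `u ∼ v` iff `H.Adj u v ∧ P u ∧ P v`. [folklore] -/
private theorem partGraph_adj (H : SimpleGraph V) (P : V → Prop) {u v : V} :
    (SimpleGraph.fromRel fun u v => H.Adj u v ∧ P u ∧ P v).Adj u v ↔ H.Adj u v ∧ P u ∧ P v := by
  rw [SimpleGraph.fromRel_adj]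
  constructor
  · rintro ⟨-, h | h⟩
    · exact h
    · exact ⟨h.1.symm, h.2.2, h.2.1⟩
  · exact fun h => ⟨h.1.ne, Or.inl h⟩

/-- The part of `H` cut out by a vertex predicate is a subgraph of `H`. [folklore] -/
private theorem partGraph_le (H : SimpleGraph V) (P : V → Prop) :
    (SimpleGraph.fromRel fun u v => H.Adj u v ∧ P u ∧ P v) ≤ H :=
  fun _ _ h => ((partGraph_adj H P).1 h).1

/-- The edges of a walk of the part of `H` cut out by `P` are edges of `H`
(the hypothesis of `SimpleGraph.Walk.transfer`). [folklore] -/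
private theorem partGraph_edges (H : SimpleGraph V) (P : V → Prop) {u v : V}
    (p : (SimpleGraph.fromRel fun u v => H.Adj u v ∧ P u ∧ P v).Walk u v) :
    ∀ e, e ∈ p.edges → e ∈ H.edgeSet :=
  fun _ he => SimpleGraph.edgeSet_mono (partGraph_le H P) (p.edges_subset_edgeSet he)

/-- A walk of the part of `H` cut out by `P` that starts in `P` stays in `P`. [folklore] -/
private theorem partGraph_support (H : SimpleGraph V) (P : V → Prop) {u v : V}
    (p : (SimpleGraph.fromRel fun u v => H.Adj u v ∧ P u ∧ P v).Walk u v) (hu : P u) :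
    ∀ z ∈ p.support, P z := by
  induction p with
  | nil =>
    intro z hz
    rw [SimpleGraph.Walk.support_nil, List.mem_singleton] at hz
    exact hz ▸ hu
  | cons h r ih =>
    intro z hz
    rw [SimpleGraph.Walk.support_cons, List.mem_cons] at hz
    rcases hz with rfl | hz
    · exact hu
    · exact ih ((partGraph_adj H P).1 h).2.2 z hz

/-- A walk of `H` all of whose vertices satisfy `P` is the transfer of a walk of the part of `H` cut out
by `P`. [folklore] -/
private theorem partGraph_lift (H : SimpleGraph V) (P : V → Prop) {u v : V} (r : H.Walk u v)
    (hr : ∀ z ∈ r.support, P z) :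
    ∃ q : (SimpleGraph.fromRel fun u v => H.Adj u v ∧ P u ∧ P v).Walk u v,
      q.transfer H (partGraph_edges H P q) = r := by
  induction r with
  | nil => exact ⟨SimpleGraph.Walk.nil, rfl⟩
  | cons h r' ih =>
    have hu : P _ := hr _ (SimpleGraph.Walk.start_mem_support _)
    have hr' : ∀ z ∈ r'.support, P z := fun z hz =>
      hr z (by rw [SimpleGraph.Walk.support_cons]; exact List.mem_cons_of_mem _ hz)
    obtain ⟨q', hq'⟩ := ih hr'
    subst hq'
    exact ⟨SimpleGraph.Walk.cons
      ((partGraph_adj H P).2 ⟨h, hu, hr' _ (SimpleGraph.Walk.start_mem_support _)⟩) q', rfl⟩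

/-- `SimpleGraph.Walk.transfer` is injective. [folklore] -/
private theorem transfer_injective' {G H : SimpleGraph V} {u v : V} (q q' : G.Walk u v)
    (hq : ∀ e, e ∈ q.edges → e ∈ H.edgeSet) (hq' : ∀ e, e ∈ q'.edges → e ∈ H.edgeSet)
    (h : q.transfer H hq = q'.transfer H hq') : q = q' := by
  induction q with
  | nil =>
    cases q' with
    | nil => rfl
    | cons h' r' =>
      refine absurd (congrArg SimpleGraph.Walk.length h) ?_
      rw [SimpleGraph.Walk.length_transfer, SimpleGraph.Walk.length_transfer,
        SimpleGraph.Walk.length_nil, SimpleGraph.Walk.length_cons]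
      omega
  | cons h₁ r ih =>
    cases q' with
    | nil =>
      refine absurd (congrArg SimpleGraph.Walk.length h) ?_
      rw [SimpleGraph.Walk.length_transfer, SimpleGraph.Walk.length_transfer,
        SimpleGraph.Walk.length_nil, SimpleGraph.Walk.length_cons]
      omega
    | cons h₁' r' =>
      simp only [SimpleGraph.Walk.transfer, SimpleGraph.Walk.cons.injEq] at h
      obtain ⟨hw, hh⟩ := h
      subst hw
      obtain rfl := ih r' _ _ (eq_of_heq hh)
      rfl

/-- If `e₁ → e₂` is the only oriented edge of `H` leaving `A`, a walk of `H` that starts outside `A` and never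
visits `e₁` stays outside `A` (entering `A` would traverse `e₂ → e₁`). [folklore] -/
private theorem support_notMem_of_oneEdgeCut (H : SimpleGraph V) (A : Set V) (e₁ e₂ : V)
    (hcut : ∀ u v, H.Adj u v → u ∈ A → v ∉ A → u = e₁ ∧ v = e₂) {u v : V} (r : H.Walk u v)
    (hu : u ∉ A) (he₁r : e₁ ∉ r.support) : ∀ z ∈ r.support, z ∉ A := by
  induction r with
  | nil =>
    intro z hz
    rw [SimpleGraph.Walk.support_nil, List.mem_singleton] at hz
    exact hz ▸ hu
  | cons h r' ih =>
    rw [SimpleGraph.Walk.support_cons, List.mem_cons, not_or] at he₁r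
    have hw : _ ∉ A := fun hw =>
      he₁r.2 ((hcut _ _ h.symm hw hu).1 ▸ SimpleGraph.Walk.start_mem_support r')
    intro z hz
    rw [SimpleGraph.Walk.support_cons, List.mem_cons] at hz
    rcases hz with rfl | hz
    · exact hu
    · exact ih hw he₁r.2 z hz

/-- The support of the concatenation (prefix inside `A`) · `e₁e₂` · (suffix outside `A`) is the
concatenation of the two supports. [folklore] -/
private theorem oneEdgeCut_join_support (H : SimpleGraph V) (A : Set V) {e₁ e₂ a b : V} (he : H.Adj e₁ e₂)
    (p : (SimpleGraph.fromRel fun u v => H.Adj u v ∧ u ∈ A ∧ v ∈ A).Walk a e₁)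
    (q : (SimpleGraph.fromRel fun u v => H.Adj u v ∧ u ∉ A ∧ v ∉ A).Walk e₂ b) :
    ((p.transfer H (partGraph_edges H (· ∈ A) p)).append
        (SimpleGraph.Walk.cons he (q.transfer H (partGraph_edges H (· ∉ A) q)))).support =
      p.support ++ q.support := by
  rw [SimpleGraph.Walk.support_append, SimpleGraph.Walk.support_cons, List.tail_cons,
    SimpleGraph.Walk.support_transfer, SimpleGraph.Walk.support_transfer]

/-- The length of the concatenation (prefix inside `A`) · `e₁e₂` · (suffix outside `A`) is
`|prefix| + |suffix| + 1`. [folklore] -/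
private theorem oneEdgeCut_join_length (H : SimpleGraph V) (A : Set V) {e₁ e₂ a b : V} (he : H.Adj e₁ e₂)
    (p : (SimpleGraph.fromRel fun u v => H.Adj u v ∧ u ∈ A ∧ v ∈ A).Walk a e₁)
    (q : (SimpleGraph.fromRel fun u v => H.Adj u v ∧ u ∉ A ∧ v ∉ A).Walk e₂ b) :
    ((p.transfer H (partGraph_edges H (· ∈ A) p)).append
        (SimpleGraph.Walk.cons he (q.transfer H (partGraph_edges H (· ∉ A) q)))).length =
      p.length + q.length + 1 := by
  rw [SimpleGraph.Walk.length_append, SimpleGraph.Walk.length_cons, SimpleGraph.Walk.length_transfer,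
    SimpleGraph.Walk.length_transfer, Nat.add_assoc]

/-- The concatenation of a self-avoiding prefix `a → e₁` inside `A` (`a ∈ A`), the cut edge `e₁e₂` and a
self-avoiding suffix `e₂ → b` outside `A` (`e₂ ∉ A`) is self-avoiding: the two pieces have disjoint
supports. [folklore] -/
private theorem oneEdgeCut_join_isPath (H : SimpleGraph V) (A : Set V) {e₁ e₂ a b : V} (he : H.Adj e₁ e₂)
    (he₂ : e₂ ∉ A) (ha : a ∈ A)
    {p : (SimpleGraph.fromRel fun u v => H.Adj u v ∧ u ∈ A ∧ v ∈ A).Walk a e₁}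
    {q : (SimpleGraph.fromRel fun u v => H.Adj u v ∧ u ∉ A ∧ v ∉ A).Walk e₂ b}
    (hp : p.IsPath) (hq : q.IsPath) :
    ((p.transfer H (partGraph_edges H (· ∈ A) p)).append
        (SimpleGraph.Walk.cons he (q.transfer H (partGraph_edges H (· ∉ A) q)))).IsPath := by
  rw [SimpleGraph.Walk.isPath_def, oneEdgeCut_join_support, List.nodup_append']
  exact ⟨(SimpleGraph.Walk.isPath_def _).1 hp, (SimpleGraph.Walk.isPath_def _).1 hq,
    fun ⦃z⦄ hzp hzq => partGraph_support H (· ∉ A) q he₂ z hzq (partGraph_support H (· ∈ A) p ha z hzp)⟩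

/-- The concatenation (prefix inside `A`) · `e₁e₂` · (suffix outside `A`) determines the prefix and the
suffix (`e₂ ∉ A`: the prefix is exactly the part before the first exit from `A`). [folklore] -/
private theorem oneEdgeCut_join_injective (H : SimpleGraph V) (A : Set V) {e₁ e₂ b : V}
    (he : H.Adj e₁ e₂) (he₂ : e₂ ∉ A)
    (q q' : (SimpleGraph.fromRel fun u v => H.Adj u v ∧ u ∉ A ∧ v ∉ A).Walk e₂ b) {a : V}
    (p p' : (SimpleGraph.fromRel fun u v => H.Adj u v ∧ u ∈ A ∧ v ∈ A).Walk a e₁)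
    (h : (p.transfer H (partGraph_edges H (· ∈ A) p)).append
        (SimpleGraph.Walk.cons he (q.transfer H (partGraph_edges H (· ∉ A) q))) =
      (p'.transfer H (partGraph_edges H (· ∈ A) p')).append
        (SimpleGraph.Walk.cons he (q'.transfer H (partGraph_edges H (· ∉ A) q')))) :
    p = p' ∧ q = q' := by
  induction p with
  | nil =>
    cases p' with
    | nil =>
      simp only [SimpleGraph.Walk.transfer, SimpleGraph.Walk.nil_append, SimpleGraph.Walk.cons.injEq,
        heq_eq_eq, true_and] at h
      exact ⟨rfl, transfer_injective' q q' _ _ h⟩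
    | cons h' r' =>
      simp only [SimpleGraph.Walk.transfer, SimpleGraph.Walk.nil_append, SimpleGraph.Walk.cons_append,
        SimpleGraph.Walk.cons.injEq] at h
      obtain ⟨hw, -⟩ := h
      subst hw
      exact absurd ((partGraph_adj H (· ∈ A)).1 h').2.2 he₂
  | cons h₁ r ih =>
    cases p' with
    | nil =>
      simp only [SimpleGraph.Walk.transfer, SimpleGraph.Walk.nil_append, SimpleGraph.Walk.cons_append,
        SimpleGraph.Walk.cons.injEq] at h
      obtain ⟨hw, -⟩ := h
      subst hw
      exact absurd ((partGraph_adj H (· ∈ A)).1 h₁).2.2 he₂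
    | cons h₁' r' =>
      simp only [SimpleGraph.Walk.transfer, SimpleGraph.Walk.cons_append, SimpleGraph.Walk.cons.injEq] at h
      obtain ⟨hw, hh⟩ := h
      subst hw
      obtain ⟨rfl, rfl⟩ := ih he r' (eq_of_heq hh)
      exact ⟨rfl, rfl⟩

/-- Every self-avoiding path of `H` from a vertex of `A` to `b ∉ A` is a concatenation
(self-avoiding prefix inside `A`) · `e₁e₂` · (self-avoiding suffix outside `A`): its first exit from `A` is the
cut edge `e₁ → e₂`, and after it the path cannot re-enter `A` without revisiting `e₁`. [folklore] -/
private theorem oneEdgeCut_join_surjective (H : SimpleGraph V) (A : Set V) {e₁ e₂ : V}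
    (hcut : ∀ u v, H.Adj u v → u ∈ A → v ∉ A → u = e₁ ∧ v = e₂) (he : H.Adj e₁ e₂) {u b : V}
    (w : H.Walk u b) (hw : w.IsPath) (hu : u ∈ A) (hb : b ∉ A) :
    ∃ (p : (SimpleGraph.fromRel fun u v => H.Adj u v ∧ u ∈ A ∧ v ∈ A).Walk u e₁)
      (q : (SimpleGraph.fromRel fun u v => H.Adj u v ∧ u ∉ A ∧ v ∉ A).Walk e₂ b),
      p.IsPath ∧ q.IsPath ∧
        (p.transfer H (partGraph_edges H (· ∈ A) p)).append
            (SimpleGraph.Walk.cons he (q.transfer H (partGraph_edges H (· ∉ A) q))) = w := by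
  induction w with
  | nil => exact absurd hu hb
  | @cons u v b h r ih =>
    rw [SimpleGraph.Walk.cons_isPath_iff] at hw
    obtain ⟨hr, hur⟩ := hw
    by_cases hv : v ∈ A
    · obtain ⟨p₀, q, hp₀, hq, hJ⟩ := ih hr hv hb
      subst hJ
      refine ⟨SimpleGraph.Walk.cons ((partGraph_adj H (· ∈ A)).2 ⟨h, hu, hv⟩) p₀, q, ?_, hq, rfl⟩
      rw [SimpleGraph.Walk.cons_isPath_iff]
      refine ⟨hp₀, fun hup => hur ?_⟩
      rw [oneEdgeCut_join_support]
      exact List.mem_append_left _ hup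
    · obtain ⟨h₁, h₂⟩ := hcut u v h hu hv
      subst h₁ h₂
      obtain ⟨q, hq⟩ :=
        partGraph_lift H (· ∉ A) r (support_notMem_of_oneEdgeCut H A _ _ hcut r hv hur)
      subst hq
      rw [SimpleGraph.Walk.isPath_def, SimpleGraph.Walk.support_transfer] at hr
      exact ⟨SimpleGraph.Walk.nil, q, SimpleGraph.Walk.IsPath.nil, (SimpleGraph.Walk.isPath_def q).2 hr,
        rfl⟩

/-- **The splitting bijection across a one-edge cut.** If `e₁ → e₂` is the only oriented edge of `H`
leaving `A` (`e₂ ∉ A`), then for `a ∈ A`, `b ∉ A` the map (prefix, suffix) ↦ prefix · `e₁e₂` · suffix is a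
bijection from (self-avoiding paths `a → e₁` inside `A`) × (self-avoiding paths `e₂ → b` outside `A`) onto
the self-avoiding paths `a → b` of `H`, of length `|prefix| + |suffix| + 1`. [folklore] -/
theorem exists_oneEdgeCut_split (H : SimpleGraph V) (A : Set V) (e₁ e₂ a b : V)
    (hcut : ∀ u v, H.Adj u v → u ∈ A → v ∉ A → u = e₁ ∧ v = e₂) (he : H.Adj e₁ e₂) (he₂ : e₂ ∉ A)
    (ha : a ∈ A) (hb : b ∉ A) :
    ∃ Φ : (SimpleGraph.fromRel fun u v => H.Adj u v ∧ u ∈ A ∧ v ∈ A).Path a e₁ ×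
        (SimpleGraph.fromRel fun u v => H.Adj u v ∧ u ∉ A ∧ v ∉ A).Path e₂ b → H.Path a b,
      Function.Bijective Φ ∧ ∀ pq, (Φ pq).1.length = pq.1.1.length + pq.2.1.length + 1 := by
  refine ⟨fun pq => ⟨(pq.1.1.transfer H (partGraph_edges H (· ∈ A) pq.1.1)).append
      (SimpleGraph.Walk.cons he (pq.2.1.transfer H (partGraph_edges H (· ∉ A) pq.2.1))),
      oneEdgeCut_join_isPath H A he he₂ ha pq.1.2 pq.2.2⟩, ⟨?_, ?_⟩,
    fun pq => oneEdgeCut_join_length H A he pq.1.1 pq.2.1⟩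
  · rintro ⟨⟨p, hp⟩, ⟨q, hq⟩⟩ ⟨⟨p', hp'⟩, ⟨q', hq'⟩⟩ h
    obtain ⟨rfl, rfl⟩ := oneEdgeCut_join_injective H A he he₂ q q' p p' (congrArg Subtype.val h)
    rfl
  · rintro ⟨w, hw⟩
    obtain ⟨p, q, hp, hq, hJ⟩ := oneEdgeCut_join_surjective H A hcut he w hw ha hb
    exact ⟨(⟨p, hp⟩, ⟨q, hq⟩), Subtype.ext hJ⟩

/-- **Factorisation of the self-avoiding path kernel across a one-edge cut.** If the vertex set `A` is left
by exactly one oriented edge `e₁ → e₂` of `H` (`hcut`; `e₁ ∈ A`, `e₂ ∉ A`), then for `a ∈ A`, `b ∉ A` and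
`0 ≤ x`

  `Z_H(a,b) = x · Z_A(a,e₁) · Z_{Aᶜ}(e₂,b)`,

`Z_A`, `Z_{Aᶜ}` being the kernels of the parts of `H` inside and outside `A`
(`SimpleGraph.fromRel fun u v => H.Adj u v ∧ u ∈ A ∧ v ∈ A`, resp. with `∉`): every self-avoiding path
`a → b` crosses the cut edge exactly once and splits uniquely there, `|γ| = |prefix| + 1 + |suffix|`.
All sums are unconditional sums in `ℝ≥0∞`; no finiteness of `H` is needed (and `e₁ ∈ A` is not used: it is
forced as soon as one path `a → b` exists). [folklore] -/
theorem stub_oneEdgeCut_factor (H : SimpleGraph V) (x : ℝ) (hx : 0 ≤ x) (A : Set V) (e₁ e₂ a b : V)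
    (hcut : ∀ u v, H.Adj u v → u ∈ A → v ∉ A → u = e₁ ∧ v = e₂)
    (he : H.Adj e₁ e₂) (he₁ : e₁ ∈ A) (he₂ : e₂ ∉ A) (ha : a ∈ A) (hb : b ∉ A) :
    pathKernel H x a b = ENNReal.ofReal x *
      (pathKernel (SimpleGraph.fromRel fun u v => H.Adj u v ∧ u ∈ A ∧ v ∈ A) x a e₁ *
        pathKernel (SimpleGraph.fromRel fun u v => H.Adj u v ∧ u ∉ A ∧ v ∉ A) x e₂ b) := by
  have _ := he₁ -- `e₁ ∈ A` is part of the registered signature but logically redundant here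
  obtain ⟨Φ, hΦ, hlen⟩ := exists_oneEdgeCut_split H A e₁ e₂ a b hcut he he₂ ha hb
  -- the weight of a split path: `x^{|prefix| + |suffix| + 1} = x^{|prefix|} · x^{|suffix|} · x`
  have hterm : ∀ pq, ENNReal.ofReal (x ^ (Φ pq).1.length) =
      ENNReal.ofReal (x ^ pq.1.1.length) * ENNReal.ofReal (x ^ pq.2.1.length) * ENNReal.ofReal x := by
    intro pq
    rw [hlen pq, pow_succ, ENNReal.ofReal_mul' hx, pow_add, ENNReal.ofReal_mul (pow_nonneg hx _)]
  -- Fubini for the product sum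
  have hprod : ∑' pq : (SimpleGraph.fromRel fun u v => H.Adj u v ∧ u ∈ A ∧ v ∈ A).Path a e₁ ×
        (SimpleGraph.fromRel fun u v => H.Adj u v ∧ u ∉ A ∧ v ∉ A).Path e₂ b,
      ENNReal.ofReal (x ^ pq.1.1.length) * ENNReal.ofReal (x ^ pq.2.1.length) =
      pathKernel (SimpleGraph.fromRel fun u v => H.Adj u v ∧ u ∈ A ∧ v ∈ A) x a e₁ *
        pathKernel (SimpleGraph.fromRel fun u v => H.Adj u v ∧ u ∉ A ∧ v ∉ A) x e₂ b := by
    unfold pathKernel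
    rw [ENNReal.tsum_prod']
    simp only [ENNReal.tsum_mul_left, ENNReal.tsum_mul_right]
  calc pathKernel H x a b
      = ∑' pq : (SimpleGraph.fromRel fun u v => H.Adj u v ∧ u ∈ A ∧ v ∈ A).Path a e₁ ×
          (SimpleGraph.fromRel fun u v => H.Adj u v ∧ u ∉ A ∧ v ∉ A).Path e₂ b,
          ENNReal.ofReal (x ^ (Φ pq).1.length) :=
        (hΦ.1.tsum_eq (f := fun γ : H.Path a b => ENNReal.ofReal (x ^ γ.1.length))
          fun γ _ => hΦ.2 γ).symm
    _ = ∑' pq : (SimpleGraph.fromRel fun u v => H.Adj u v ∧ u ∈ A ∧ v ∈ A).Path a e₁ ×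
          (SimpleGraph.fromRel fun u v => H.Adj u v ∧ u ∉ A ∧ v ∉ A).Path e₂ b,
          ENNReal.ofReal (x ^ pq.1.1.length) * ENNReal.ofReal (x ^ pq.2.1.length) * ENNReal.ofReal x :=
        tsum_congr hterm
    _ = ENNReal.ofReal x *
          (pathKernel (SimpleGraph.fromRel fun u v => H.Adj u v ∧ u ∈ A ∧ v ∈ A) x a e₁ *
            pathKernel (SimpleGraph.fromRel fun u v => H.Adj u v ∧ u ∉ A ∧ v ∉ A) x e₂ b) := by
        rw [ENNReal.tsum_mul_right, hprod, mul_comm]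

end Summit.CriticalPhenomena.SAWScalingLimit.Theorems.BoundaryTP2
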